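import Summits.Ventures.CertifiedManyBodySolver.Rows.DopedTLCorrWindow
import HarnessLib

/-!
# AFFINE («Lagrangian») thermodynamic-limit correlator rows of the `t–t'` square lattice: what a window
# certificate proves BEFORE the energy window is inserted, and the certified FAST LAYER it yields
# (re-pricing every observable edge under any later energy window at zero solver cost) — crew hubbard-obs, D-0042 R1b

HONEST FRAMING: first certified bounds on pairing observables / stiffness CEILINGS; not a superconductivity
verdict; every number certified (two lineages + referee) or labelled float. NOTHING IS ASSERTED HERE: every
bound-valued statement is a `def … : Prop` or takes row predicates as hypotheses; no `sorry`, no new axiom, no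
named fact; zero compute. Seat hubbard-obs-p2 (STIFFNESS), `prover-hubbard-obs-p2-g7-0`; companion of
`Rows/DopedTLCorr.lean` §B (ONE-row predicates `SquareTTPrimeCorrLowerRow tp U n u r Λ X`, energy hypothesis
`energyDensityTT' 1 tp U n ≤ u`) and `Rows/DopedTLCorrWindow.lean` §A (TWO-row predicates `…RowW (lo hi r)`).
Spec: HOME/hubbard-obs-p2/STIFFNESS-LINE.md v2 §5 (fast layer, corrected 2026-08-26).

WHAT A WINDOW CERTIFICATE ACTUALLY PROVES. An observable edge of the cell is the dual certificate of the word
SDP `min ω(X)` over the host's state class 𝒦 (translation-invariant, PSD moment blocks, stationarity / Ward / kkt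
rows, filling rows) cut by the energy rows `ω(h) ≤ hi` (multiplier `κhi ≥ 0`) and `ω(h) ≥ lo` (multiplier
`κlo ≥ 0`). Dual feasibility (the PSD/SOS part, the stationarity and filling multipliers, the `ℓ¹` residual) does
NOT involve the right-hand sides `hi, lo`; weak duality is the IDENTITY
`ω(X) − q = P(ω) + κhi·(hi − ω(h)) + κlo·(ω(h) − lo)` with `P ≥ 0` on 𝒦, i.e. for EVERY state of the class —
no window assumed —
  `ω(X) ≥ q + κhi·(hi − ω(h)) + κlo·(ω(h) − lo)`                                            (★)
(this is the inequality `hle` inside the tree soundness theorem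
`InfVolFermionState.IsTorusLimitOf.re_sum_expect_d4_ge_of_window_certificate_TT'_ineq`, one line before the
slack `κ (u − e₀) ≥ 0` is dropped). For a torus-limit GROUND state `ω(h) = e₀ := energyDensityTT' 1 tp U n`
(`IsTorusLimitOf.meanEnergy_hubbardTTPrime_eq_energyDensityTT'`), so (★) is an affine inequality in the ONE
unknown real `e₀`, and every certified window `lo' ≤ e₀ ≤ hi'` — the one the certificate was solved with, or any
LATER, better or worse, one — turns the SAME certificate into the number
  `q' = q + κhi·(hi − hi') + κlo·(lo' − lo)`                                                   (re-pricing)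
exactly, in seconds, with no new solve, no new claim node and no new referee booking: the literals
`(q, hi, lo, κhi, κlo)` are fields of the certificate file that both reader lineages already print.

* §A `SquareTTPrimeCorrAffineLowerRow / AffineUpperRow / AffineOrbitLowerRow (tp U n) (q hi lo κhi κlo) Λ X` — the
  state class of `Rows/DopedTLCorr.lean` §B verbatim, NO energy hypothesis, conclusion (★) (lower), its mirror
  `Re ω(X) ≤ q − κhi(hi − e₀) − κlo(e₀ − lo)` (upper), and the `D₄`-orbit-mean form (the honest conclusion of a
  point-group-reduced certificate); M3′ cells `M3CorrAffineLowerRow / …UpperRow / …OrbitLowerRow` at `U = 8`, `n = 7/8`.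
* §B THE FAST LAYER (solver-free edges): `…AffineLowerRow.lowerRow_of_floor` — an affine row with `κhi, κlo ≥ 0`
  and a certified floor `lo' ≤ e₀` IS the one-row predicate `SquareTTPrimeCorrLowerRow tp U n hi' q'` at EVERY cap
  `hi'` with the re-priced value `q'`; `.rowW` — the two-row predicate on every window `[lo', hi']`; `.lowerRow_self`
  — at the certificate's own window the value is `q` (today's numeric claim nodes are the special case);
  `reprice_ge_of_window_le` — a tighter window never loses (`hi' ≤ hi`, `lo ≤ lo'` ⇒ `q ≤ q'`); the same for upper and
  orbit rows; negation; `.uncond` at the M3′ point from the typed energy rows of `Statement.lean`.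
* §C ACROSS HAMILTONIANS NOTHING TRANSFERS FOR FREE (recorded, not typed): the class 𝒦 carries stationarity rows
  `ω([h_U, X_j]) = 0` and kkt blocks that are `H_U`-specific; the ground state at `U' ≠ U` violates them by
  `(U − U')·ω([d, X_j])`, so a certificate at `U` bounds observables at `U'` only through an ENVELOPE carrying
  `|U − U'|·Σ_j |p_j|·‖[d, X_j]‖` (eom multipliers × operator norms) — a per-certificate Lipschitz constant to be
  measured, not a row of this file.

Measured slopes of record (certificate fields, 2026-08-26; STIFFNESS-LINE.md v2 §2): A0′ kinetic edge `kinlo`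
`κhi = 140513187083/2³⁸ ≈ 0.5112`, `κlo = 2⁻³⁷`; A0′ `stiffK3` `κhi = 340626488337/2⁴⁰ ≈ 0.3098`, `κlo = 9·2⁻³⁹`;
A0 `kinx` `κhi = 35522924679/2³⁸ ≈ 0.1292`, `κlo = 7·2⁻³⁹` — every stiffness edge loads the CAP row only, so a
better certified UPPER energy bound `hi' < hi` tightens each ceiling by `κhi·(hi − hi')` the minute it lands.

References: J. Wang et al., PRX 14 (2024) 031006, §III eq. (obsopt) [WangEtAl2024]; S. Boyd, L. Vandenberghe,
*Convex Optimization* (2004), §5.6 (sensitivity of the optimal value = the dual variables) [BoydVandenberghe2004].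
-/

noncomputable section

namespace Summit.Ventures.CertifiedManyBodySolver

open Literature.MathematicalPhysics.QuantumLattice
open Matrix HubbardWave0 Literature.Probability.LatticeModels ThermodynamicLimit Filter Topology
open scoped ComplexOrder BigOperators

/-! ## §A  Affine (Lagrangian) correlator predicates (`t = 1`, NNN hopping `tp`, coupling `U`, density `n`) -/

section Defs

/-- §A (AFFINE LOWER form). Square lattice `ℤ²`, `t = 1`, NNN hopping `tp`, coupling `U`, density `n`: for
every torus limit `ω` of unit ground states `ψ` of the sectors `(rectN n L_j, S^z = 0)` of
`hubbardTorusTT' L_j 1 tp U` along `L_j → ∞` — WITHOUT any energy hypothesis —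
`q + κhi·(hi − e₀) + κlo·(e₀ − lo) ≤ Re ω(X)`, `e₀ = energyDensityTT' 1 tp U n`: the weak-duality inequality (★)
of a two-energy-row window certificate with value `q`, rows `e ≤ hi` (multiplier `κhi`) and `e ≥ lo` (multiplier
`κlo`), read on ground-state torus limits (`ω(h) = e₀`). [cite: WangEtAl2024, §III] -/
def SquareTTPrimeCorrAffineLowerRow (tp U n : ℝ) (q hi lo κhi κlo : ℚ) (Λ : Finset (Site 2))
    (X : FermionOp Λ) : Prop :=
  ∀ (ω : InfVolFermionState 2) (Ls : ℕ → ℕ) (ψ : ∀ L, Fock (Orb (FermionTorus 2 L))),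
    Tendsto Ls atTop atTop →
    (∀ j, IsGroundStateInSector (hubbardTorusTT' (Ls j) 1 tp U) (rectN n (Ls j)) 0 (ψ (Ls j))) →
    (∀ j, star (ψ (Ls j)) ⬝ᵥ ψ (Ls j) = 1) → ω.IsTorusLimitOf ψ Ls →
    ((q : ℚ) : ℝ) + ((κhi : ℚ) : ℝ) * (((hi : ℚ) : ℝ) - energyDensityTT' 1 tp U n) +
        ((κlo : ℚ) : ℝ) * (energyDensityTT' 1 tp U n - ((lo : ℚ) : ℝ)) ≤ (ω.expect Λ X).re

/-- §A (AFFINE UPPER form): same state class, no energy hypothesis, conclusion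
`Re ω(X) ≤ q − κhi·(hi − e₀) − κlo·(e₀ − lo)` (the certificate of `max ω(X)`, value `q`). [cite: WangEtAl2024, §III] -/
def SquareTTPrimeCorrAffineUpperRow (tp U n : ℝ) (q hi lo κhi κlo : ℚ) (Λ : Finset (Site 2))
    (X : FermionOp Λ) : Prop :=
  ∀ (ω : InfVolFermionState 2) (Ls : ℕ → ℕ) (ψ : ∀ L, Fock (Orb (FermionTorus 2 L))),
    Tendsto Ls atTop atTop →
    (∀ j, IsGroundStateInSector (hubbardTorusTT' (Ls j) 1 tp U) (rectN n (Ls j)) 0 (ψ (Ls j))) →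
    (∀ j, star (ψ (Ls j)) ⬝ᵥ ψ (Ls j) = 1) → ω.IsTorusLimitOf ψ Ls →
    (ω.expect Λ X).re ≤ ((q : ℚ) : ℝ) - ((κhi : ℚ) : ℝ) * (((hi : ℚ) : ℝ) - energyDensityTT' 1 tp U n) -
        ((κlo : ℚ) : ℝ) * (energyDensityTT' 1 tp U n - ((lo : ℚ) : ℝ))

/-- §A (AFFINE `D₄`-ORBIT-MEAN form; the honest conclusion of a point-group-reduced certificate — a torus limit of
sector ground states need not be `D₄`-invariant when the sector ground space is degenerate): same state class, no
energy hypothesis, conclusion `q + κhi·(hi − e₀) + κlo·(e₀ − lo) ≤ |S|⁻¹ Σ_{γ ∈ S} Re ω_{γΛ}(Γ(d4Emb γ 0) X)`.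
[cite: WangEtAl2024, §III] -/
def SquareTTPrimeCorrAffineOrbitLowerRow (tp U n : ℝ) (q hi lo κhi κlo : ℚ) (S : Finset (DihedralGroup 4))
    (Λ : Finset (Site 2)) (X : FermionOp Λ) : Prop :=
  ∀ (ω : InfVolFermionState 2) (Ls : ℕ → ℕ) (ψ : ∀ L, Fock (Orb (FermionTorus 2 L))),
    Tendsto Ls atTop atTop →
    (∀ j, IsGroundStateInSector (hubbardTorusTT' (Ls j) 1 tp U) (rectN n (Ls j)) 0 (ψ (Ls j))) →
    (∀ j, star (ψ (Ls j)) ⬝ᵥ ψ (Ls j) = 1) → ω.IsTorusLimitOf ψ Ls →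
    ((q : ℚ) : ℝ) + ((κhi : ℚ) : ℝ) * (((hi : ℚ) : ℝ) - energyDensityTT' 1 tp U n) +
        ((κlo : ℚ) : ℝ) * (energyDensityTT' 1 tp U n - ((lo : ℚ) : ℝ)) ≤
      (S.card : ℝ)⁻¹ * ∑ g ∈ S, (ω.expect (d4ShiftSet g 0 Λ) (fermionEmbed (PolySite.d4Emb g 0 Λ) X)).re

/-- M3′ AFFINE lower cell at the canonical point `U = 8`, `n = 7/8` (δ = 1/8), NNN hopping `tp`. -/
def M3CorrAffineLowerRow (tp : ℝ) (q hi lo κhi κlo : ℚ) (Λ : Finset (Site 2)) (X : FermionOp Λ) : Prop :=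
  SquareTTPrimeCorrAffineLowerRow tp 8 (7 / 8) q hi lo κhi κlo Λ X

/-- M3′ AFFINE upper cell at the canonical point. -/
def M3CorrAffineUpperRow (tp : ℝ) (q hi lo κhi κlo : ℚ) (Λ : Finset (Site 2)) (X : FermionOp Λ) : Prop :=
  SquareTTPrimeCorrAffineUpperRow tp 8 (7 / 8) q hi lo κhi κlo Λ X

/-- M3′ AFFINE `D₄`-orbit-mean cell at the canonical point (the production form of the cell's reduced
certificates: kinlo / stiffK3 / kinx / P_d / F₂ edges). -/
def M3CorrAffineOrbitLowerRow (tp : ℝ) (q hi lo κhi κlo : ℚ) (S : Finset (DihedralGroup 4))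
    (Λ : Finset (Site 2)) (X : FermionOp Λ) : Prop :=
  SquareTTPrimeCorrAffineOrbitLowerRow tp 8 (7 / 8) q hi lo κhi κlo S Λ X

end Defs

/-! ## §B  The fast layer: solver-free re-pricing edges -/

section Edges

variable {tp U n : ℝ} {q hi lo κhi κlo hi' lo' : ℚ} {S : Finset (DihedralGroup 4)}
  {Λ : Finset (Site 2)} {X : FermionOp Λ}

/-- The re-priced value of a window certificate `(q; hi, lo; κhi, κlo)` under a window `[lo', hi']`:
`q' = q + κhi·(hi − hi') + κlo·(lo' − lo)`. [cite: BoydVandenberghe2004, §5.6] -/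
def reprice (q hi lo κhi κlo hi' lo' : ℚ) : ℚ := q + κhi * (hi - hi') + κlo * (lo' - lo)

/-- At the certificate's own window the re-priced value is the certificate value. -/
@[simp] theorem reprice_self : reprice q hi lo κhi κlo hi lo = q := by
  simp [reprice]

/-- A TIGHTER window never loses: `hi' ≤ hi`, `lo ≤ lo'`, `κhi, κlo ≥ 0` ⇒ `q ≤ q'`. -/
theorem le_reprice_of_window_le (hκhi : 0 ≤ κhi) (hκlo : 0 ≤ κlo) (hhi : hi' ≤ hi) (hlo : lo ≤ lo') :
    q ≤ reprice q hi lo κhi κlo hi' lo' := by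
  have h1 : 0 ≤ κhi * (hi - hi') := mul_nonneg hκhi (sub_nonneg.2 hhi)
  have h2 : 0 ≤ κlo * (lo' - lo) := mul_nonneg hκlo (sub_nonneg.2 hlo)
  simp only [reprice]
  linarith

/-- Re-pricing is monotone in the cap: a better cap `hi'' ≤ hi'` gives a larger (tighter) lower value. -/
theorem reprice_mono_cap {hi'' : ℚ} (hκhi : 0 ≤ κhi) (h : hi'' ≤ hi') :
    reprice q hi lo κhi κlo hi' lo' ≤ reprice q hi lo κhi κlo hi'' lo' := by
  simp only [reprice]
  nlinarith [mul_le_mul_of_nonneg_left h hκhi]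

/-- The pointwise arithmetic behind every re-pricing: from (★) at the unknown `e₀ ∈ [lo', hi']` to the number `q'`. -/
theorem reprice_le_affine {e₀ : ℝ} (hκhi : 0 ≤ κhi) (hκlo : 0 ≤ κlo) (hlo' : ((lo' : ℚ) : ℝ) ≤ e₀)
    (hhi' : e₀ ≤ ((hi' : ℚ) : ℝ)) :
    ((reprice q hi lo κhi κlo hi' lo' : ℚ) : ℝ) ≤
      ((q : ℚ) : ℝ) + ((κhi : ℚ) : ℝ) * (((hi : ℚ) : ℝ) - e₀) + ((κlo : ℚ) : ℝ) * (e₀ - ((lo : ℚ) : ℝ)) := by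
  have hκhi' : (0 : ℝ) ≤ ((κhi : ℚ) : ℝ) := by exact_mod_cast hκhi
  have hκlo' : (0 : ℝ) ≤ ((κlo : ℚ) : ℝ) := by exact_mod_cast hκlo
  have h1 : ((κhi : ℚ) : ℝ) * (((hi : ℚ) : ℝ) - ((hi' : ℚ) : ℝ)) ≤ ((κhi : ℚ) : ℝ) * (((hi : ℚ) : ℝ) - e₀) :=
    mul_le_mul_of_nonneg_left (by linarith) hκhi'
  have h2 : ((κlo : ℚ) : ℝ) * (((lo' : ℚ) : ℝ) - ((lo : ℚ) : ℝ)) ≤ ((κlo : ℚ) : ℝ) * (e₀ - ((lo : ℚ) : ℝ)) :=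
    mul_le_mul_of_nonneg_left (by linarith) hκlo'
  simp only [reprice]
  push_cast
  linarith

/-- **THE FAST LAYER (lower edges).** An affine row with `κhi, κlo ≥ 0` and a certified energy FLOOR `lo' ≤ e₀`
is the ONE-row lower predicate of `Rows/DopedTLCorr.lean` at EVERY cap `hi'`, with the re-priced value
`q' = q + κhi(hi − hi') + κlo(lo' − lo)`: the same certificate bytes serve every later energy window.
[cite: BoydVandenberghe2004, §5.6] -/
theorem SquareTTPrimeCorrAffineLowerRow.lowerRow_of_floor
    (h : SquareTTPrimeCorrAffineLowerRow tp U n q hi lo κhi κlo Λ X) (hκhi : 0 ≤ κhi) (hκlo : 0 ≤ κlo)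
    (hlo' : ((lo' : ℚ) : ℝ) ≤ energyDensityTT' 1 tp U n) :
    SquareTTPrimeCorrLowerRow tp U n hi' (reprice q hi lo κhi κlo hi' lo') Λ X :=
  fun ω Ls ψ hLs hψ hψ1 hω hhi' =>
    (reprice_le_affine hκhi hκlo hlo' hhi').trans (h ω Ls ψ hLs hψ hψ1 hω)

/-- **THE FAST LAYER (two-row form).** An affine row with `κhi, κlo ≥ 0` is the TWO-row predicate
`SquareTTPrimeCorrLowerRowW tp U n lo' hi' q'` of `Rows/DopedTLCorrWindow.lean` on EVERY window `[lo', hi']`. -/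
theorem SquareTTPrimeCorrAffineLowerRow.rowW
    (h : SquareTTPrimeCorrAffineLowerRow tp U n q hi lo κhi κlo Λ X) (hκhi : 0 ≤ κhi) (hκlo : 0 ≤ κlo) :
    SquareTTPrimeCorrLowerRowW tp U n lo' hi' (reprice q hi lo κhi κlo hi' lo') Λ X :=
  fun ω Ls ψ hLs hψ hψ1 hω hlo' hhi' =>
    (reprice_le_affine hκhi hκlo hlo' hhi').trans (h ω Ls ψ hLs hψ hψ1 hω)

/-- At the certificate's OWN window: the numeric claim node of record (`(lo ≤ e₀) → LowerRow hi q`) is the special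
case `hi' = hi`, `lo' = lo` of the fast layer. -/
theorem SquareTTPrimeCorrAffineLowerRow.lowerRow_self
    (h : SquareTTPrimeCorrAffineLowerRow tp U n q hi lo κhi κlo Λ X) (hκhi : 0 ≤ κhi) (hκlo : 0 ≤ κlo)
    (hlo : ((lo : ℚ) : ℝ) ≤ energyDensityTT' 1 tp U n) :
    SquareTTPrimeCorrLowerRow tp U n hi q Λ X := by
  simpa using h.lowerRow_of_floor (hi' := hi) hκhi hκlo hlo

/-- **THE FAST LAYER (upper edges).** Mirror statement: an affine upper row with `κhi, κlo ≥ 0` and a certified floor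
`lo' ≤ e₀` is the one-row UPPER predicate at every cap `hi'` with value `q − κhi(hi − hi') − κlo(lo' − lo)`
(`= −reprice (−q) …`, a SMALLER = tighter ceiling for a tighter window). [cite: BoydVandenberghe2004, §5.6] -/
theorem SquareTTPrimeCorrAffineUpperRow.upperRow_of_floor
    (h : SquareTTPrimeCorrAffineUpperRow tp U n q hi lo κhi κlo Λ X) (hκhi : 0 ≤ κhi) (hκlo : 0 ≤ κlo)
    (hlo' : ((lo' : ℚ) : ℝ) ≤ energyDensityTT' 1 tp U n) :
    SquareTTPrimeCorrUpperRow tp U n hi' (-reprice (-q) hi lo κhi κlo hi' lo') Λ X := by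
  intro ω Ls ψ hLs hψ hψ1 hω hhi'
  have h1 := reprice_le_affine (q := -q) (hi := hi) (lo := lo) hκhi hκlo hlo' hhi'
  have h2 := h ω Ls ψ hLs hψ hψ1 hω
  push_cast at h1 h2 ⊢
  linarith

/-- Two-row form of the upper fast layer. -/
theorem SquareTTPrimeCorrAffineUpperRow.rowW
    (h : SquareTTPrimeCorrAffineUpperRow tp U n q hi lo κhi κlo Λ X) (hκhi : 0 ≤ κhi) (hκlo : 0 ≤ κlo) :
    SquareTTPrimeCorrUpperRowW tp U n lo' hi' (-reprice (-q) hi lo κhi κlo hi' lo') Λ X := by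
  intro ω Ls ψ hLs hψ hψ1 hω hlo' hhi'
  have h1 := reprice_le_affine (q := -q) (hi := hi) (lo := lo) hκhi hκlo hlo' hhi'
  have h2 := h ω Ls ψ hLs hψ hψ1 hω
  push_cast at h1 h2 ⊢
  linarith

/-- At the certificate's own window (upper edges). -/
theorem SquareTTPrimeCorrAffineUpperRow.upperRow_self
    (h : SquareTTPrimeCorrAffineUpperRow tp U n q hi lo κhi κlo Λ X) (hκhi : 0 ≤ κhi) (hκlo : 0 ≤ κlo)
    (hlo : ((lo : ℚ) : ℝ) ≤ energyDensityTT' 1 tp U n) :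
    SquareTTPrimeCorrUpperRow tp U n hi q Λ X := by
  simpa using h.upperRow_of_floor (hi' := hi) hκhi hκlo hlo

/-- **THE FAST LAYER (`D₄`-orbit-mean edges — the production form).** An affine orbit row with `κhi, κlo ≥ 0` and a
certified floor `lo' ≤ e₀` is the orbit lower predicate `SquareTTPrimeCorrOrbitLowerRow tp U n hi' q' S Λ X` at
EVERY cap `hi'`. [cite: BoydVandenberghe2004, §5.6] -/
theorem SquareTTPrimeCorrAffineOrbitLowerRow.orbitLowerRow_of_floor
    (h : SquareTTPrimeCorrAffineOrbitLowerRow tp U n q hi lo κhi κlo S Λ X) (hκhi : 0 ≤ κhi)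
    (hκlo : 0 ≤ κlo) (hlo' : ((lo' : ℚ) : ℝ) ≤ energyDensityTT' 1 tp U n) :
    SquareTTPrimeCorrOrbitLowerRow tp U n hi' (reprice q hi lo κhi κlo hi' lo') S Λ X :=
  fun ω Ls ψ hLs hψ hψ1 hω hhi' =>
    (reprice_le_affine hκhi hκlo hlo' hhi').trans (h ω Ls ψ hLs hψ hψ1 hω)

/-- Two-row form of the orbit fast layer. -/
theorem SquareTTPrimeCorrAffineOrbitLowerRow.orbitRowW
    (h : SquareTTPrimeCorrAffineOrbitLowerRow tp U n q hi lo κhi κlo S Λ X) (hκhi : 0 ≤ κhi)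
    (hκlo : 0 ≤ κlo) :
    SquareTTPrimeCorrOrbitLowerRowW tp U n lo' hi' (reprice q hi lo κhi κlo hi' lo') S Λ X :=
  fun ω Ls ψ hLs hψ hψ1 hω hlo' hhi' =>
    (reprice_le_affine hκhi hκlo hlo' hhi').trans (h ω Ls ψ hLs hψ hψ1 hω)

/-- At the certificate's own window (orbit edges): today's numeric orbit claim nodes are this special case. -/
theorem SquareTTPrimeCorrAffineOrbitLowerRow.orbitLowerRow_self
    (h : SquareTTPrimeCorrAffineOrbitLowerRow tp U n q hi lo κhi κlo S Λ X) (hκhi : 0 ≤ κhi)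
    (hκlo : 0 ≤ κlo) (hlo : ((lo : ℚ) : ℝ) ≤ energyDensityTT' 1 tp U n) :
    SquareTTPrimeCorrOrbitLowerRow tp U n hi q S Λ X := by
  simpa using h.orbitLowerRow_of_floor (hi' := hi) hκhi hκlo hlo

/-- Affine UPPER rows from affine LOWER rows on the negated objective (linearity of `ω.expect`). -/
theorem SquareTTPrimeCorrAffineUpperRow.of_lower_neg
    (h : SquareTTPrimeCorrAffineLowerRow tp U n (-q) hi lo κhi κlo Λ (-X)) :
    SquareTTPrimeCorrAffineUpperRow tp U n q hi lo κhi κlo Λ X := by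
  intro ω Ls ψ hLs hψ hψ1 hω
  have hh := h ω Ls ψ hLs hψ hψ1 hω
  rw [map_neg, Complex.neg_re] at hh
  push_cast at hh ⊢
  linarith

/-- Affine LOWER rows from affine UPPER rows on the negated objective. -/
theorem SquareTTPrimeCorrAffineLowerRow.of_upper_neg
    (h : SquareTTPrimeCorrAffineUpperRow tp U n (-q) hi lo κhi κlo Λ (-X)) :
    SquareTTPrimeCorrAffineLowerRow tp U n q hi lo κhi κlo Λ X := by
  intro ω Ls ψ hLs hψ hψ1 hω
  have hh := h ω Ls ψ hLs hψ hψ1 hω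
  rw [map_neg, Complex.neg_re] at hh
  push_cast at hh ⊢
  linarith

/-- The affine orbit row at the trivial label set `S = {1}` IS the plain affine row. -/
theorem squareTTPrimeCorrAffineOrbitLowerRow_singleton_one_iff :
    SquareTTPrimeCorrAffineOrbitLowerRow tp U n q hi lo κhi κlo {1} Λ X ↔
      SquareTTPrimeCorrAffineLowerRow tp U n q hi lo κhi κlo Λ X := by
  unfold SquareTTPrimeCorrAffineOrbitLowerRow SquareTTPrimeCorrAffineLowerRow
  simp only [Finset.sum_singleton, Finset.card_singleton, Nat.cast_one, inv_one, one_mul,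
    InfVolFermionState.expect_fermionEmbed_d4Emb_one_zero]

/-- A one-energy-row (CAP-ONLY) certificate is the affine row with `κlo = 0`; its re-pricing ignores the floor:
`q' = q + κhi(hi − hi')`. -/
theorem reprice_capOnly : reprice q hi lo κhi 0 hi' lo' = q + κhi * (hi - hi') := by
  simp [reprice]

end Edges

/-! ## §B′  The M3′ point: unconditional shapes from the typed energy rows of `Statement.lean` -/

section M3

variable {tp : ℝ} {q hi lo κhi κlo hi' lo' : ℚ} {S : Finset (DihedralGroup 4)} {Λ : Finset (Site 2)}
  {X : FermionOp Λ}

/-- M3′ fast layer: an affine orbit cell + the typed two-sided energy row `M3EnergyRow tp lo' hi'` ⇒ the orbit-mean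
bound `q'` for EVERY state of the class (no hypothesis left but the two rows). -/
theorem M3CorrAffineOrbitLowerRow.uncond (h : M3CorrAffineOrbitLowerRow tp q hi lo κhi κlo S Λ X)
    (hκhi : 0 ≤ κhi) (hκlo : 0 ≤ κlo) (hE : M3EnergyRow tp lo' hi') :
    ∀ (ω : InfVolFermionState 2) (Ls : ℕ → ℕ) (ψ : ∀ L, Fock (Orb (FermionTorus 2 L))),
      Tendsto Ls atTop atTop →
      (∀ j, IsGroundStateInSector (hubbardTorusTT' (Ls j) 1 tp 8) (rectN (7 / 8) (Ls j)) 0 (ψ (Ls j))) →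
      (∀ j, star (ψ (Ls j)) ⬝ᵥ ψ (Ls j) = 1) → ω.IsTorusLimitOf ψ Ls →
      ((reprice q hi lo κhi κlo hi' lo' : ℚ) : ℝ) ≤
        (S.card : ℝ)⁻¹ * ∑ g ∈ S, (ω.expect (d4ShiftSet g 0 Λ) (fermionEmbed (PolySite.d4Emb g 0 Λ) X)).re :=
  fun ω Ls ψ hLs hψ hψ1 hω =>
    (reprice_le_affine hκhi hκlo hE.1 hE.2).trans (h ω Ls ψ hLs hψ hψ1 hω)

/-- M3′ fast layer, one-row cell: affine orbit cell + typed floor `M3EnergyLowerRow tp lo'` ⇒ the orbit cell of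
`Rows/DopedTLCorr.lean` at every cap `hi'` with value `q'`. -/
theorem M3CorrAffineOrbitLowerRow.orbitLowerRow_of_floor (h : M3CorrAffineOrbitLowerRow tp q hi lo κhi κlo S Λ X)
    (hκhi : 0 ≤ κhi) (hκlo : 0 ≤ κlo) (hlo' : M3EnergyLowerRow tp lo') :
    M3CorrOrbitLowerRow tp hi' (reprice q hi lo κhi κlo hi' lo') S Λ X :=
  SquareTTPrimeCorrAffineOrbitLowerRow.orbitLowerRow_of_floor h hκhi hκlo hlo'

/-- M3′ fast layer, plain lower cell. -/
theorem M3CorrAffineLowerRow.lowerRow_of_floor (h : M3CorrAffineLowerRow tp q hi lo κhi κlo Λ X)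
    (hκhi : 0 ≤ κhi) (hκlo : 0 ≤ κlo) (hlo' : M3EnergyLowerRow tp lo') :
    M3CorrLowerRow tp hi' (reprice q hi lo κhi κlo hi' lo') Λ X :=
  SquareTTPrimeCorrAffineLowerRow.lowerRow_of_floor h hκhi hκlo hlo'

/-- M3′ fast layer, plain upper cell. -/
theorem M3CorrAffineUpperRow.upperRow_of_floor (h : M3CorrAffineUpperRow tp q hi lo κhi κlo Λ X)
    (hκhi : 0 ≤ κhi) (hκlo : 0 ≤ κlo) (hlo' : M3EnergyLowerRow tp lo') :
    M3CorrUpperRow tp hi' (-reprice (-q) hi lo κhi κlo hi' lo') Λ X :=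
  SquareTTPrimeCorrAffineUpperRow.upperRow_of_floor h hκhi hκlo hlo'

/-- NON-VACUITY ⇒ CONSISTENCY: an affine LOWER cell and an affine UPPER cell on the same word, each with non-negative
multipliers, re-priced under a window that holds, never cross (`q'_lo ≤ q'_hi`) — two certificates that did would
REFUTE the window (an event, not a bracket). -/
theorem M3CorrAffineLowerRow.reprice_le_of_upper (hl : M3CorrAffineLowerRow tp q hi lo κhi κlo Λ X)
    {q₂ hi₂ lo₂ κhi₂ κlo₂ : ℚ} (hu : M3CorrAffineUpperRow tp q₂ hi₂ lo₂ κhi₂ κlo₂ Λ X)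
    (hκhi : 0 ≤ κhi) (hκlo : 0 ≤ κlo) (hκhi₂ : 0 ≤ κhi₂) (hκlo₂ : 0 ≤ κlo₂) (hE : M3EnergyRow tp lo' hi') :
    reprice q hi lo κhi κlo hi' lo' ≤ -reprice (-q₂) hi₂ lo₂ κhi₂ κlo₂ hi' lo' :=
  M3CorrLowerRow.le_of_upperRow (hl.lowerRow_of_floor hκhi hκlo hE.1) (hu.upperRow_of_floor hκhi₂ hκlo₂ hE.1)
    hE.2

end M3

end Summit.Ventures.CertifiedManyBodySolver

end
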